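import Mathlib
import HarnessLib
import Summits.CriticalPhenomena.PercolationContinuityZ3.Theorems.PercLowPointHalfSpaceBoundaryTwoArmDecayStubCensusStaple

/-!
# Crux `PercLowPointHalfSpace.BoundaryTwoArmDecay` (stmt-CriticalPhenomena-0911), line
# `staircase-bootstrap-floor-decoupling` — stub `stub_census`, part IV: the root transport

Helper file for the registered stub `stub_census` (TRUNCATED LEVEL CENSUS `P(A_n ∧ K_n ≤ k) ≤ C·k·e_n`) of the
skeleton `Cruxes/BoundaryTwoArmDecay/Lines/staircase_bootstrap_floor_decoupling.lean`; lands with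
`--supports stmt-CriticalPhenomena-0911` (registered sub-goal `stub_census_rootTransport`). Definition-free; the
objects are those of `PercLowPointHalfSpaceBoundaryTwoArmDecayStubCensusDefs.lean`.

Write `U = C_ℍ(0)`, `PK = PK n 0 ω` its partner-kiss edges (`K_n = |PK|`), `κ_n = kap n`,
`A_n = {U n-tall, C_ℍ(e) n-tall, 0 ↮_ℍ e}` (`e = (0,1,0)`).

* `psi n k a ω` — on `{C_ℍ(a) n-tall, at most k partner-kiss edges}` the number of partner-kiss edges of `C_ℍ(a)`
  starting at `a`; it is covariant under horizontal shifts, and the root transport function `fRT` (mass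
  `psi/|U ∩ ∂ℍ|` from the root to every floor point of its cluster) is diagonally invariant;
* `lintegral_psi_le` — the floor MTP (`stub_census_floorMTP`) applied to `fRT`:
  `∫ psi(0) dP = ∫ 1{U n-tall, K_n ≤ k} K_n/|U ∩ ∂ℍ| dP ≤ k κ_n` (`PK` is finite on the BGN event, so `K_n`
  is its honest cardinality);
* `stub_census_rootTransport` — on `A_n ∩ {K_n ≤ k}` the floor edge `(0, e)` is a partner-kiss edge, so
  `psi(0) ≥ 1`; Markov: **`P(A_n ∩ {K_n ≤ k}) ≤ k κ_n`**.

Sources: R. Lyons – Y. Peres, *Probability on Trees and Networks* (2016), §8.2 (mass transport).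
-/

noncomputable section

namespace Summit.CriticalPhenomena.PercolationContinuityZ3.Theorems.BoundaryTwoArmDecay

open MeasureTheory Filter Topology
open Literature.Probability.Percolation Literature.Probability.LatticeModels
open scoped ENNReal

namespace StubCensus

open LowPoint (conn_symm conn_trans conn_refl conn_mono conn_iff_mem_cluster lintegral_shift)
open Negative (μ)

/-! ### The partner count `psi` and the root transport function `fRT` -/

/-- `psi n k a` is measurable. -/
theorem measurable_psi (n k : ℕ) (a : Site 3) : Measurable (psi n k a) := by
  have hset : {ω' : BondConfig (Site 3) | ω' ∈ tall (halfSpace 3) n a ∧ (PK n a ω').ncard ≤ k} =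
      tall (halfSpace 3) n a ∩ {ω' | (PK n a ω').ncard ≤ k} := by
    ext ω
    simp only [Set.mem_setOf_eq, Set.mem_inter_iff]
  unfold psi
  rw [hset]
  refine Measurable.indicator ?_ ((measurableSet_tall _ _ _).inter ?_)
  · exact (Measurable.of_discrete (f := fun m : ℕ∞ => (m : ℝ≥0∞))).comp (measurable_encard.comp
      (measurable_set_iff.2 fun q => measurableSet_setOf.1 (measurableSet_mem_PK n a (a, q))))
  · exact (measurable_ncard.comp (measurable_PK n a)) (MeasurableSet.of_discrete (s := Set.Iic k))

/-- Covariance of `psi` under horizontal shifts. -/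
theorem psi_shift (n k : ℕ) (ω : BondConfig (Site 3)) (a v : Site 3) (hv : v 0 = 0) :
    psi n k (a + v) (BondConfig.relabel (sym2Equiv (Site.shift v)) ω) = psi n k a ω := by
  unfold psi
  have hmem : BondConfig.relabel (sym2Equiv (Site.shift v)) ω ∈ {ω' : BondConfig (Site 3) |
      ω' ∈ tall (halfSpace 3) n (a + v) ∧ (PK n (a + v) ω').ncard ≤ k} ↔
      ω ∈ {ω' : BondConfig (Site 3) | ω' ∈ tall (halfSpace 3) n a ∧ (PK n a ω').ncard ≤ k} := by
    simp only [Set.mem_setOf_eq, tall_shift_iff hv (add_mem_halfSpace_iff hv), PK_shift hv,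
      Set.ncard_image_of_injective _ (pairShift_injective v)]
  have hfib : Prod.mk (a + v) ⁻¹' PK n (a + v) (BondConfig.relabel (sym2Equiv (Site.shift v)) ω) =
      (· + v) '' (Prod.mk a ⁻¹' PK n a ω) := by
    ext q
    simp only [Set.mem_preimage, Set.mem_image]
    constructor
    · intro h
      refine ⟨q - v, ?_, sub_add_cancel q v⟩
      have := (mem_PK_shift_iff hv n a ω (a, q - v)).1
      simp only [sub_add_cancel] at this
      exact this h
    · rintro ⟨w, hw, rfl⟩
      exact (mem_PK_shift_iff hv n a ω (a, w)).2 hw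
  by_cases h : ω ∈ {ω' : BondConfig (Site 3) | ω' ∈ tall (halfSpace 3) n a ∧ (PK n a ω').ncard ≤ k}
  · rw [Set.indicator_of_mem (hmem.2 h), Set.indicator_of_mem h, hfib, (add_left_injective v).injOn.encard_image]
  · rw [Set.indicator_of_notMem (fun h' => h (hmem.1 h')), Set.indicator_of_notMem h]

/-- `fRT n k · a b` is measurable. -/
theorem measurable_fRT (n k : ℕ) (a b : Site 3) : Measurable fun ω => fRT n k ω a b := by
  have hset : {ω' : BondConfig (Site 3) | a 0 = 0 ∧ b 0 = 0 ∧ b ∈ cl (halfSpace 3) a ω'} =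
      {_ω | a 0 = 0 ∧ b 0 = 0} ∩ {ω' | b ∈ cl (halfSpace 3) a ω'} := by
    ext ω
    simp only [Set.mem_setOf_eq, Set.mem_inter_iff]
    tauto
  unfold fRT
  rw [hset]
  exact ((measurable_psi n k a).mul (measurable_fl_inv _ _ _)).indicator
    ((MeasurableSet.const _).inter (measurableSet_mem_cl _ a b))

/-- `fRT` is diagonally invariant under horizontal shifts. -/
theorem fRT_shift (n k : ℕ) (ω : BondConfig (Site 3)) (a b v : Site 3) (hv : v 0 = 0) :
    fRT n k (BondConfig.relabel (sym2Equiv (Site.shift v)) ω) (a + v) (b + v) = fRT n k ω a b := by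
  unfold fRT
  have hmem : BondConfig.relabel (sym2Equiv (Site.shift v)) ω ∈ {ω' : BondConfig (Site 3) | (a + v) 0 = 0 ∧
      (b + v) 0 = 0 ∧ b + v ∈ cl (halfSpace 3) (a + v) ω'} ↔
      ω ∈ {ω' : BondConfig (Site 3) | a 0 = 0 ∧ b 0 = 0 ∧ b ∈ cl (halfSpace 3) a ω'} := by
    simp only [Set.mem_setOf_eq, Pi.add_apply, hv, add_zero, mem_cl_shift_iff (add_mem_halfSpace_iff hv)]
  by_cases h : ω ∈ {ω' : BondConfig (Site 3) | a 0 = 0 ∧ b 0 = 0 ∧ b ∈ cl (halfSpace 3) a ω'}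
  · rw [Set.indicator_of_mem (hmem.2 h), Set.indicator_of_mem h, psi_shift n k ω a v hv,
      fl_shift hv (add_mem_halfSpace_iff hv)]
  · rw [Set.indicator_of_notMem (fun h' => h (hmem.1 h')), Set.indicator_of_notMem h]

/-- **Out-mass of the root transport**: `Σ_{b ∈ ∂ℍ} fRT(ω, 0, b) = psi(0) |U ∩ ∂ℍ|⁻¹ |U ∩ ∂ℍ|`. -/
theorem tsum_fRT_left (n k : ℕ) (ω : BondConfig (Site 3)) :
    ∑' b, {b : Site 3 | b 0 = 0}.indicator (fRT n k ω 0) b =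
      psi n k 0 ω * ((((fl (halfSpace 3) 0 0 ω : ℕ∞) : ℝ≥0∞))⁻¹ * ((fl (halfSpace 3) 0 0 ω : ℕ∞) : ℝ≥0∞)) := by
  set c : ℝ≥0∞ := psi n k 0 ω * (((fl (halfSpace 3) 0 0 ω : ℕ∞) : ℝ≥0∞))⁻¹ with hc
  have hterm : ∀ b, {b : Site 3 | b 0 = 0}.indicator (fRT n k ω 0) b =
      (cl (halfSpace 3) 0 ω ∩ {u | u 0 = 0}).indicator (fun _ => c) b := by
    intro b
    by_cases hb0 : b 0 = 0
    · rw [Set.indicator_of_mem (show b ∈ {b : Site 3 | b 0 = 0} from hb0)]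
      unfold fRT
      by_cases hb : b ∈ cl (halfSpace 3) 0 ω
      · rw [Set.indicator_of_mem (show ω ∈ {ω' : BondConfig (Site 3) | (0 : Site 3) 0 = 0 ∧ b 0 = 0 ∧
            b ∈ cl (halfSpace 3) 0 ω'} from ⟨rfl, hb0, hb⟩), Set.indicator_of_mem (show b ∈ cl (halfSpace 3) 0 ω ∩
            {u | u 0 = 0} from ⟨hb, hb0⟩)]
      · rw [Set.indicator_of_notMem (show ω ∉ {ω' : BondConfig (Site 3) | (0 : Site 3) 0 = 0 ∧ b 0 = 0 ∧
            b ∈ cl (halfSpace 3) 0 ω'} from fun h => hb h.2.2), Set.indicator_of_notMem (show b ∉ cl (halfSpace 3) 0 ω ∩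
            {u | u 0 = 0} from fun h => hb h.1)]
    · rw [Set.indicator_of_notMem (show b ∉ {b : Site 3 | b 0 = 0} from hb0),
        Set.indicator_of_notMem (show b ∉ cl (halfSpace 3) 0 ω ∩ {u | u 0 = 0} from fun h => hb0 h.2)]
  rw [tsum_congr hterm, ← tsum_subtype, ENNReal.tsum_set_const,
    show (cl (halfSpace 3) 0 ω ∩ {u | u 0 = 0}).encard = fl (halfSpace 3) 0 0 ω from rfl, hc]
  ring

/-- Counting a set of pairs through its fibres. -/
theorem encard_eq_tsum_fiber (s : Set (Site 3 × Site 3)) :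
    (((s.encard : ℕ∞)) : ℝ≥0∞) = ∑' a : Site 3, ((((Prod.mk a ⁻¹' s).encard : ℕ∞)) : ℝ≥0∞) := by
  have h1 : (((s.encard : ℕ∞)) : ℝ≥0∞) = ∑' q, s.indicator (fun _ => (1 : ℝ≥0∞)) q := by
    rw [← ENNReal.tsum_set_one]
    exact tsum_subtype s (fun _ => (1 : ℝ≥0∞))
  have h2 : ∀ a : Site 3, ((((Prod.mk a ⁻¹' s).encard : ℕ∞)) : ℝ≥0∞) =
      ∑' b, (Prod.mk a ⁻¹' s).indicator (fun _ => (1 : ℝ≥0∞)) b := by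
    intro a
    rw [← ENNReal.tsum_set_one]
    exact tsum_subtype (Prod.mk a ⁻¹' s) (fun _ => (1 : ℝ≥0∞))
  rw [h1, ENNReal.tsum_prod']
  refine tsum_congr fun a => ?_
  rw [h2]
  exact tsum_congr fun b => rfl

/-- **In-mass of the root transport**: `Σ_{a ∈ ∂ℍ} fRT(ω, a, 0) = 1{U n-tall, K ≤ k} |PK|/|U ∩ ∂ℍ|`. -/
theorem tsum_fRT_right (n k : ℕ) (ω : BondConfig (Site 3)) :
    ∑' a, {a : Site 3 | a 0 = 0}.indicator (fun a => fRT n k ω a 0) a =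
      {ω : BondConfig (Site 3) | ω ∈ tall (halfSpace 3) n 0 ∧ (PK n 0 ω).ncard ≤ k}.indicator
        (fun ω => (((fl (halfSpace 3) 0 0 ω : ℕ∞) : ℝ≥0∞))⁻¹ * (((PK n 0 ω).encard : ℕ∞) : ℝ≥0∞)) ω := by
  have hterm : ∀ a, {a : Site 3 | a 0 = 0}.indicator (fun a => fRT n k ω a 0) a =
      {ω : BondConfig (Site 3) | ω ∈ tall (halfSpace 3) n 0 ∧ (PK n 0 ω).ncard ≤ k}.indicator
        (fun ω => (((fl (halfSpace 3) 0 0 ω : ℕ∞) : ℝ≥0∞))⁻¹ *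
          ((((Prod.mk a ⁻¹' PK n 0 ω).encard : ℕ∞)) : ℝ≥0∞)) ω := by
    intro a
    by_cases ha0 : a 0 = 0
    · rw [Set.indicator_of_mem (show a ∈ {a : Site 3 | a 0 = 0} from ha0)]
      unfold fRT
      by_cases ha : (0 : Site 3) ∈ cl (halfSpace 3) a ω
      · have haU : a ∈ cl (halfSpace 3) 0 ω := conn_symm ha
        rw [Set.indicator_of_mem (show ω ∈ {ω' : BondConfig (Site 3) | a 0 = 0 ∧ (0 : Site 3) 0 = 0 ∧
            0 ∈ cl (halfSpace 3) a ω'} from ⟨ha0, rfl, ha⟩)]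
        unfold psi
        rw [fl_eq_of_mem haU]
        have hmem : ω ∈ {ω' : BondConfig (Site 3) | ω' ∈ tall (halfSpace 3) n a ∧ (PK n a ω').ncard ≤ k} ↔
            ω ∈ {ω' : BondConfig (Site 3) | ω' ∈ tall (halfSpace 3) n 0 ∧ (PK n 0 ω').ncard ≤ k} := by
          simp only [Set.mem_setOf_eq, tall_iff_of_mem haU, PK_eq_of_mem haU]
        by_cases h : ω ∈ {ω' : BondConfig (Site 3) | ω' ∈ tall (halfSpace 3) n 0 ∧ (PK n 0 ω').ncard ≤ k}
        · rw [Set.indicator_of_mem (hmem.2 h), Set.indicator_of_mem h, PK_eq_of_mem haU, mul_comm]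
        · rw [Set.indicator_of_notMem (fun h' => h (hmem.1 h')), Set.indicator_of_notMem h, zero_mul]
      · rw [Set.indicator_of_notMem (show ω ∉ {ω' : BondConfig (Site 3) | a 0 = 0 ∧ (0 : Site 3) 0 = 0 ∧
            0 ∈ cl (halfSpace 3) a ω'} from fun h => ha h.2.2)]
        have hfib : Prod.mk a ⁻¹' PK n 0 ω = ∅ :=
          Set.eq_empty_iff_forall_notMem.2 fun q hq => ha (conn_symm hq.2.2.2.1)
        symm
        by_cases h : ω ∈ {ω' : BondConfig (Site 3) | ω' ∈ tall (halfSpace 3) n 0 ∧ (PK n 0 ω').ncard ≤ k}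
        · rw [Set.indicator_of_mem h, hfib, Set.encard_empty]
          simp
        · exact Set.indicator_of_notMem h _
    · rw [Set.indicator_of_notMem (show a ∉ {a : Site 3 | a 0 = 0} from ha0)]
      have hfib : Prod.mk a ⁻¹' PK n 0 ω = ∅ := Set.eq_empty_iff_forall_notMem.2 fun q hq => ha0 hq.1
      symm
      by_cases h : ω ∈ {ω' : BondConfig (Site 3) | ω' ∈ tall (halfSpace 3) n 0 ∧ (PK n 0 ω').ncard ≤ k}
      · rw [Set.indicator_of_mem h, hfib, Set.encard_empty]
        simp
      · exact Set.indicator_of_notMem h _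
  rw [tsum_congr hterm]
  by_cases h : ω ∈ {ω : BondConfig (Site 3) | ω ∈ tall (halfSpace 3) n 0 ∧ (PK n 0 ω).ncard ≤ k}
  · simp only [Set.indicator_of_mem h]
    rw [ENNReal.tsum_mul_left, encard_eq_tsum_fiber]
  · simp only [Set.indicator_of_notMem h, tsum_zero]

/-- On the good event the partner-kiss edges of `U` form a finite set. -/
theorem PK_finite {ω : BondConfig (Site 3)}
    (hfin : ∀ v : Site 3, (halfSpaceCluster (BondConfig.relabel (sym2Equiv (Site.shift v)) ω)).Finite)
    (n : ℕ) : (PK n 0 ω).Finite := by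
  have hsub : PK n 0 ω ⊆ ⋃ a ∈ cl (halfSpace 3) 0 ω ∩ {u | u 0 = 0},
      (fun b => (a, b)) '' ((zdGraph 3).neighborSet a) := by
    intro q hq
    simp only [Set.mem_iUnion, Set.mem_image, exists_prop]
    exact ⟨q.1, ⟨hq.2.2.2.1, hq.1⟩, q.2, hq.2.2.1, rfl⟩
  refine Set.Finite.subset ?_ hsub
  exact ((finite_cl_halfSpace hfin rfl).subset Set.inter_subset_left).biUnion fun a _ =>
    ((zdGraph 3).neighborSet a).toFinite.image _

/-- **The root transport**: `∫ psi(0) dP ≤ k κ_n` (floor MTP with `fRT`; on the good event `|PK| = K_n ≤ k`). -/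
theorem lintegral_psi_le (n k : ℕ) : ∫⁻ ω, psi n k 0 ω ∂μ ≤ k * kap n := by
  have hT := stub_census_floorMTP (criticalProbI 3) (fRT n k) (measurable_fRT n k) (fRT_shift n k)
  have hmeasK : Measurable fun ω : BondConfig (Site 3) => {ω : BondConfig (Site 3) | ω ∈ tall (halfSpace 3) n 0 ∧
      (PK n 0 ω).Nonempty}.indicator (fun ω => (((fl (halfSpace 3) 0 0 ω : ℕ∞) : ℝ≥0∞))⁻¹) ω := by
    have hset : {ω : BondConfig (Site 3) | ω ∈ tall (halfSpace 3) n 0 ∧ (PK n 0 ω).Nonempty} =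
        tall (halfSpace 3) n 0 ∩ ⋃ q : Site 3 × Site 3, {ω | q ∈ PK n 0 ω} := by
      ext ω
      simp only [Set.mem_setOf_eq, Set.mem_inter_iff, Set.mem_iUnion, Set.Nonempty]
    rw [hset]
    exact (measurable_fl_inv _ _ _).indicator ((measurableSet_tall _ _ _).inter
      (MeasurableSet.iUnion fun q => measurableSet_mem_PK n 0 q))
  calc ∫⁻ ω, psi n k 0 ω ∂μ
      = ∫⁻ ω, ∑' b, {b : Site 3 | b 0 = 0}.indicator (fRT n k ω 0) b ∂μ := by
        refine lintegral_congr_ae ?_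
        filter_upwards [ae_good] with ω hω
        rw [tsum_fRT_left]
        have h0 : ((fl (halfSpace 3) 0 0 ω : ℕ∞) : ℝ≥0∞) ≠ 0 := (lt_of_lt_of_le zero_lt_one (one_le_fl rfl ω)).ne'
        have htop : ((fl (halfSpace 3) 0 0 ω : ℕ∞) : ℝ≥0∞) ≠ ⊤ := ENat.toENNReal_ne_top.2
          ((finite_cl_halfSpace hω.2 rfl).subset Set.inter_subset_left).encard_lt_top.ne
        rw [ENNReal.inv_mul_cancel h0 htop, mul_one]
    _ = ∫⁻ ω, ∑' a, {a : Site 3 | a 0 = 0}.indicator (fun a => fRT n k ω a 0) a ∂μ := hT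
    _ = ∫⁻ ω, {ω : BondConfig (Site 3) | ω ∈ tall (halfSpace 3) n 0 ∧ (PK n 0 ω).ncard ≤ k}.indicator
          (fun ω => (((fl (halfSpace 3) 0 0 ω : ℕ∞) : ℝ≥0∞))⁻¹ * (((PK n 0 ω).encard : ℕ∞) : ℝ≥0∞)) ω ∂μ :=
        lintegral_congr fun ω => tsum_fRT_right n k ω
    _ ≤ ∫⁻ ω, k * {ω : BondConfig (Site 3) | ω ∈ tall (halfSpace 3) n 0 ∧ (PK n 0 ω).Nonempty}.indicator
          (fun ω => (((fl (halfSpace 3) 0 0 ω : ℕ∞) : ℝ≥0∞))⁻¹) ω ∂μ := by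
        refine lintegral_mono_ae ?_
        filter_upwards [ae_good] with ω hω
        by_cases h : ω ∈ tall (halfSpace 3) n 0 ∧ (PK n 0 ω).ncard ≤ k
        · rw [Set.indicator_of_mem (show ω ∈ {ω : BondConfig (Site 3) | ω ∈ tall (halfSpace 3) n 0 ∧
            (PK n 0 ω).ncard ≤ k} from h)]
          by_cases hne : (PK n 0 ω).Nonempty
          · rw [Set.indicator_of_mem (show ω ∈ {ω : BondConfig (Site 3) | ω ∈ tall (halfSpace 3) n 0 ∧
              (PK n 0 ω).Nonempty} from ⟨h.1, hne⟩), mul_comm (k : ℝ≥0∞)]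
            gcongr
            rw [← (PK_finite hω.2 n).cast_ncard_eq, ENat.toENNReal_coe]
            exact_mod_cast h.2
          · rw [Set.not_nonempty_iff_eq_empty.1 hne, Set.encard_empty]
            simp
        · rw [Set.indicator_of_notMem (show ω ∉ {ω : BondConfig (Site 3) | ω ∈ tall (halfSpace 3) n 0 ∧
            (PK n 0 ω).ncard ≤ k} from h)]
          exact bot_le
    _ = k * kap n := by rw [lintegral_const_mul _ hmeasK, kap]

end StubCensus

/-- **The root transport bound** (registered sub-goal `stub_census_rootTransport` of `stub_census`): at `p_c(ℤ³)`,
`P(A_n ∩ {K_n ≤ k}) ≤ k · κ_n`, `κ_n = E[1{U n-tall, U has a partner-kiss edge}/|U ∩ ∂ℍ|]` — on `A_n` the floor edge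
`(0, e)` is a partner-kiss edge of `U`, Markov, and the floor mass transport of the partner count `psi`. -/
theorem stub_census_rootTransport : ∀ n k : ℕ,
    (bondPercolation (zdGraph 3) (criticalProbI 3))
        ({ω | (∃ y : Site 3, (n : ℤ) ≤ y 0 ∧ ω ∈ openConnIn (halfSpace 3) 0 y) ∧
            (∃ y : Site 3, (n : ℤ) ≤ y 0 ∧ ω ∈ openConnIn (halfSpace 3) ((0 : Site 3) + Pi.single 1 1) y) ∧
            ω ∉ openConnIn (halfSpace 3) 0 ((0 : Site 3) + Pi.single 1 1)} ∩
          {ω | {q : Site 3 × Site 3 | q.1 0 = 0 ∧ q.2 0 = 0 ∧ (zdGraph 3).Adj q.1 q.2 ∧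
              ω ∈ openConnIn (halfSpace 3) 0 q.1 ∧ ω ∉ openConnIn (halfSpace 3) 0 q.2 ∧
              ∃ y : Site 3, (n : ℤ) ≤ y 0 ∧ ω ∈ openConnIn (halfSpace 3) q.2 y}.ncard ≤ k}) ≤
      k * ∫⁻ ω, {ω : BondConfig (Site 3) | (∃ y : Site 3, (n : ℤ) ≤ y 0 ∧ ω ∈ openConnIn (halfSpace 3) 0 y) ∧
          {q : Site 3 × Site 3 | q.1 0 = 0 ∧ q.2 0 = 0 ∧ (zdGraph 3).Adj q.1 q.2 ∧
            ω ∈ openConnIn (halfSpace 3) 0 q.1 ∧ ω ∉ openConnIn (halfSpace 3) 0 q.2 ∧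
            ∃ y : Site 3, (n : ℤ) ≤ y 0 ∧ ω ∈ openConnIn (halfSpace 3) q.2 y}.Nonempty}.indicator
        (fun ω => (((halfSpaceFootprint ω : ℕ∞) : ENNReal))⁻¹) ω ∂(bondPercolation (zdGraph 3) (criticalProbI 3)) := by
  intro n k
  have hsub : ({ω | (∃ y : Site 3, (n : ℤ) ≤ y 0 ∧ ω ∈ openConnIn (halfSpace 3) 0 y) ∧
      (∃ y : Site 3, (n : ℤ) ≤ y 0 ∧ ω ∈ openConnIn (halfSpace 3) ((0 : Site 3) + Pi.single 1 1) y) ∧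
      ω ∉ openConnIn (halfSpace 3) 0 ((0 : Site 3) + Pi.single 1 1)} ∩
      {ω | {q : Site 3 × Site 3 | q.1 0 = 0 ∧ q.2 0 = 0 ∧ (zdGraph 3).Adj q.1 q.2 ∧
        ω ∈ openConnIn (halfSpace 3) 0 q.1 ∧ ω ∉ openConnIn (halfSpace 3) 0 q.2 ∧
        ∃ y : Site 3, (n : ℤ) ≤ y 0 ∧ ω ∈ openConnIn (halfSpace 3) q.2 y}.ncard ≤ k} : Set (BondConfig (Site 3))) ⊆
      {ω | 1 ≤ StubCensus.psi n k 0 ω} := by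
    rintro ω ⟨⟨ht0, hte, hne⟩, hk⟩
    have hPK : ((0 : Site 3), (0 : Site 3) + Pi.single 1 1) ∈ StubCensus.PK n 0 ω := by
      refine ⟨rfl, by simp, ?_, LowPoint.conn_refl ω (zero_mem_halfSpace 3), hne, hte⟩
      exact (zdGraph_adj_iff _ _).2 ⟨1, Or.inl rfl⟩
    show 1 ≤ StubCensus.psi n k 0 ω
    unfold StubCensus.psi
    rw [Set.indicator_of_mem (show ω ∈ {ω' : BondConfig (Site 3) | ω' ∈ StubCensus.tall (halfSpace 3) n 0 ∧
      (StubCensus.PK n 0 ω').ncard ≤ k} from ⟨ht0, hk⟩), ← ENat.toENNReal_one, ENat.toENNReal_le,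
      Set.one_le_encard_iff_nonempty]
    exact ⟨(0 : Site 3) + Pi.single 1 1, hPK⟩
  calc (bondPercolation (zdGraph 3) (criticalProbI 3)) _
      ≤ (bondPercolation (zdGraph 3) (criticalProbI 3)) {ω | 1 ≤ StubCensus.psi n k 0 ω} := measure_mono hsub
    _ = 1 * (bondPercolation (zdGraph 3) (criticalProbI 3)) {ω | 1 ≤ StubCensus.psi n k 0 ω} := (one_mul _).symm
    _ ≤ ∫⁻ ω, StubCensus.psi n k 0 ω ∂(bondPercolation (zdGraph 3) (criticalProbI 3)) :=
        mul_meas_ge_le_lintegral (StubCensus.measurable_psi n k 0) 1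
    _ ≤ _ := StubCensus.lintegral_psi_le n k

end Summit.CriticalPhenomena.PercolationContinuityZ3.Theorems.BoundaryTwoArmDecay

end
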